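import Literature.NumberTheory.DiophantineGeometry.GenEllProjLineExamples
import HarnessLib

/-!
# The S-unit quadratic family of the `λ`-line: the compactly bounded subset `K_∞ = B̄(1/2, 1/2 − ε) ∪ B̄(R+2, R+1−ε)`
# containing every real root of `X² − (2 + r)X + r`, `1 ≤ r ≤ R`

Record-only file (D-0012) of the abc-iut cell (R2 S-chain team, seat abc-iut-s2-p4 gen 4); TAKES NO SIDE on [IUTchIII] Cor.
3.12. S. Mochizuki, *Arithmetic elliptic curves in general position* [MochizukiGenEll2010], Ex. 1.3 (ii) p. 5 ("compactly
bounded subsets": `V ∋ ∞`, `K_v ⊆ X(ℚ̄_v)` compact domains, points all of whose conjugates lie in `K_v`).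

WHY. The tree's PROVED (P4) ⟹ (P6) (`Cor22.condP6_of_seven_le`, abc-iut-S-d1) and abc-iut-s2-p1's
`PointDict.not_hvol_of_frequently_highMixedPoint` quantify over ONE `CBData`. The points `λ_{a,c}` of the S-unit family
(`LDHSUnitFamilyField`) are real quadratic with conjugates the two roots of `X² − (2 + r)X + r`, `r = 5^a/7^c ∈ [1, R]`: one in
`[1/3, 1 − 1/(R+1)]`, the other in `(2, R + 2)`. THIS FILE supplies a `CBData` with empty nonarchimedean support whose `K_∞` is
the union of two closed discs `|z − 1/2| ≤ 1/2 − ε`, `|z − (R+2)| ≤ R + 1 − ε` (`ε = 1/(2(R+1))`) — a compact domain stable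
under complex conjugation avoiding `0, 1` — and proves that every complex root of `z² − (2+r)z + r` (`1 ≤ r ≤ R`) lies in it.
Elementary; nothing asserted about Θ-data; no side taken. [cite: MochizukiGenEll2010, Ex 1.3 (ii) p.5]
-/

noncomputable section

open Metric

namespace Summit.ABC.IUTFork.SUnitFamily

open Literature.NumberTheory.DiophantineGeometry.GenEll

/-- The archimedean domain: `B̄(1/2, 1/2 − ε) ∪ B̄(R + 2, R + 1 − ε)`, `ε = 1/(2(R+1))`. [cite: MochizukiGenEll2010, Ex 1.3 (ii) p.5] -/
def twoDiscs (R : ℝ) : Set ℂ :=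
  closedBall ((2 : ℂ)⁻¹) (2⁻¹ - 1 / (2 * (R + 1))) ∪ closedBall ((R + 2 : ℝ) : ℂ) (R + 1 - 1 / (2 * (R + 1)))

/-- For `R ≥ 1` both radii are positive. [folklore] -/
private theorem radii_pos {R : ℝ} (hR : 1 ≤ R) : 0 < 2⁻¹ - 1 / (2 * (R + 1)) ∧ 0 < R + 1 - 1 / (2 * (R + 1)) := by
  have h1 : 1 / (2 * (R + 1)) ≤ 1 / 4 :=
    one_div_le_one_div_of_le (by norm_num) (by linarith)
  constructor <;> linarith

/-- Closure of the interior of a union of two closed discs of positive radius is the union. [folklore] -/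
private theorem closure_interior_union_closedBall {x y : ℂ} {r t : ℝ} (hr : 0 < r) (ht : 0 < t) :
    closure (interior (closedBall x r ∪ closedBall y t)) = closedBall x r ∪ closedBall y t := by
  apply subset_antisymm
  · calc closure (interior (closedBall x r ∪ closedBall y t)) ⊆ closure (closedBall x r ∪ closedBall y t) :=
          closure_mono interior_subset
      _ = closedBall x r ∪ closedBall y t := (isClosed_closedBall.union isClosed_closedBall).closure_eq
  · have hx : closedBall x r ⊆ closure (interior (closedBall x r ∪ closedBall y t)) := by
      calc closedBall x r = closure (interior (closedBall x r)) := by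
            rw [interior_closedBall x hr.ne', closure_ball x hr.ne']
        _ ⊆ closure (interior (closedBall x r ∪ closedBall y t)) :=
            closure_mono (interior_mono Set.subset_union_left)
    have hy : closedBall y t ⊆ closure (interior (closedBall x r ∪ closedBall y t)) := by
      calc closedBall y t = closure (interior (closedBall y t)) := by
            rw [interior_closedBall y ht.ne', closure_ball y ht.ne']
        _ ⊆ closure (interior (closedBall x r ∪ closedBall y t)) :=
            closure_mono (interior_mono Set.subset_union_right)
    exact Set.union_subset hx hy

/-- **The compactly bounded subset `K_{∞}(R)`** with support `{∞}` and archimedean domain `twoDiscs R` (`R ≥ 1`).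
[cite: MochizukiGenEll2010, Ex 1.3 (ii) p.5] -/
def cbTwoDiscs (R : ℝ) (hR : 1 ≤ R) : CBData where
  primes := ∅
  primes_prime := by simp
  Karc := twoDiscs R
  Knon := fun _ _ => ∅
  Karc_nonempty := ⟨2⁻¹, Or.inl (mem_closedBall_self (radii_pos hR).1.le)⟩
  Karc_isCompact := (isCompact_closedBall _ _).union (isCompact_closedBall _ _)
  Karc_closure_interior := closure_interior_union_closedBall (radii_pos hR).1 (radii_pos hR).2
  Karc_conj := by
    intro z hz
    rcases hz with hz | hz
    · left
      rw [mem_closedBall, dist_eq_norm] at hz ⊢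
      have h : (starRingEnd ℂ) z - 2⁻¹ = (starRingEnd ℂ) (z - 2⁻¹) := by rw [map_sub, map_inv₀, map_ofNat]
      rwa [h, RCLike.norm_conj]
    · right
      rw [mem_closedBall, dist_eq_norm] at hz ⊢
      have h : (starRingEnd ℂ) z - ((R + 2 : ℝ) : ℂ) = (starRingEnd ℂ) (z - ((R + 2 : ℝ) : ℂ)) := by
        rw [map_sub, Complex.conj_ofReal]
      rwa [h, RCLike.norm_conj]
  Karc_subset := by
    have hε : 0 < 1 / (2 * (R + 1)) := by positivity
    intro z hz
    rcases hz with hz | hz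
    · rw [mem_closedBall, dist_eq_norm] at hz
      constructor
      · rintro rfl
        rw [zero_sub, norm_neg, norm_inv, Complex.norm_ofNat] at hz
        linarith
      · rintro rfl
        have h : (1 : ℂ) - 2⁻¹ = 2⁻¹ := by norm_num
        rw [h, norm_inv, Complex.norm_ofNat] at hz
        linarith
    · rw [mem_closedBall, dist_eq_norm] at hz
      constructor
      · rintro rfl
        rw [zero_sub, norm_neg, Complex.norm_real, Real.norm_eq_abs, abs_of_pos (by linarith)] at hz
        linarith
      · rintro rfl
        have h : (1 : ℂ) - ((R + 2 : ℝ) : ℂ) = ((-(R + 1) : ℝ) : ℂ) := by push_cast; ring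
        rw [h, Complex.norm_real, Real.norm_eq_abs, abs_of_neg (by linarith)] at hz
        linarith
  Knon_nonempty := fun p hp => absurd hp (by simp)
  Knon_galois := fun p hp => absurd hp (by simp)
  Knon_compactDomain := fun p hp => absurd hp (by simp)
  Knon_subset := fun p hp => absurd hp (by simp)

/-- The support of `K_∞(R)` is `{∞}` (no finite primes). [cite: MochizukiGenEll2010, Ex 1.3 (ii) p.5] -/
@[simp] theorem cbTwoDiscs_primes (R : ℝ) (hR : 1 ≤ R) : (cbTwoDiscs R hR).primes = ∅ := rfl

/-- The archimedean domain of `K_∞(R)` is `twoDiscs R`. [cite: MochizukiGenEll2010, Ex 1.3 (ii) p.5] -/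
theorem cbTwoDiscs_Karc (R : ℝ) (hR : 1 ≤ R) : (cbTwoDiscs R hR).Karc = twoDiscs R := rfl

/-! ## The roots of `z² − (2 + r)z + r` lie in `twoDiscs R` for `1 ≤ r ≤ R` -/

/-- A complex root of `z² − (2+r)z + r` (`r` real, `r ≥ 1`) is real. [folklore] -/
theorem im_eq_zero_of_root {r : ℝ} (hr : 1 ≤ r) {z : ℂ} (hz : z ^ 2 - (2 + (r : ℂ)) * z + r = 0) : z.im = 0 := by
  have hre := congrArg Complex.re hz
  have him := congrArg Complex.im hz
  simp only [Complex.sub_re, Complex.add_re, Complex.mul_re, Complex.sub_im, Complex.add_im, Complex.mul_im,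
    Complex.ofReal_re, Complex.ofReal_im, Complex.zero_re, Complex.zero_im, pow_two, Complex.re_ofNat,
    Complex.im_ofNat] at hre him
  -- imaginary part: `2·re·im − (2+r)·im = 0`
  by_contra hne
  have hre2 : z.re = (2 + r) / 2 := by
    have : (2 * z.re - (2 + r)) * z.im = 0 := by nlinarith [him]
    rcases mul_eq_zero.mp this with h | h
    · linarith
    · exact absurd h hne
  -- real part: `re² − im² − (2+r)·re + r = 0` gives `im² = r − (2+r)²/4 < 0`
  have : z.im * z.im = z.re * z.re - (2 + r) * z.re + r := by nlinarith [hre]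
  rw [hre2] at this
  have hneg : z.im * z.im < 0 := by rw [this]; nlinarith
  exact absurd hneg (not_lt.mpr (mul_self_nonneg _))

/-- A real root `x` of `x² − (2+r)x + r` with `1 ≤ r ≤ R` lies in `[1/3, 1 − 1/(R+1)]` or in `[2, R + 2]`. [folklore] -/
theorem real_root_cases {r R x : ℝ} (hr : 1 ≤ r) (hrR : r ≤ R) (hx : x ^ 2 - (2 + r) * x + r = 0) :
    (1 / 3 ≤ x ∧ x ≤ 1 - 1 / (R + 1)) ∨ (2 ≤ x ∧ x ≤ R + 2) := by
  -- `x·((2 + r) − x) = r > 0` and `(1 − x)·((1 + r) − x) = 1 > 0`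
  have h1 : x * ((2 + r) - x) = r := by nlinarith [hx]
  have h2 : (1 - x) * ((1 + r) - x) = 1 := by nlinarith [hx]
  have hxpos : 0 < x := by
    by_contra h
    push Not at h
    nlinarith [h1]
  have hxlt : x < 2 + r := by
    by_contra h; push Not at h; nlinarith [h1]
  rcases lt_or_ge x 1 with hlt | hge
  · left
    have hA : 0 < (1 + r) - x := by linarith
    constructor
    · -- `x = r/((2+r) − x) ≥ r/(2+r) ≥ 1/3`
      have : 3 * x * ((2 + r) - x) ≥ (2 + r) - x := by nlinarith [h1]
      nlinarith
    · -- `1 − x = 1/((1+r) − x) ≥ 1/(1+r) ≥ 1/(R+1)`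
      have hle : 1 / (R + 1) ≤ 1 / ((1 + r) - x) :=
        one_div_le_one_div_of_le hA (by linarith)
      have heq : 1 - x = 1 / ((1 + r) - x) := by
        field_simp
        linarith [h2]
      linarith [heq ▸ hle]
  · right
    have h1x : 1 - x ≤ 0 := by linarith
    have : (1 + r) - x < 0 := by
      by_contra h; push Not at h
      nlinarith [h2]
    constructor <;> nlinarith [h1]

/-- **Every complex root of `z² − (2 + r)z + r` with `1 ≤ r ≤ R` lies in `K_∞(R)`.** [cite: MochizukiGenEll2010, Ex 1.3 (ii) p.5] -/
theorem root_mem_twoDiscs {r R : ℝ} (hr : 1 ≤ r) (hrR : r ≤ R) {z : ℂ} (hz : z ^ 2 - (2 + (r : ℂ)) * z + r = 0) :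
    z ∈ twoDiscs R := by
  have him := im_eq_zero_of_root hr hz
  have hzx : z = (z.re : ℂ) := by
    apply Complex.ext <;> simp [him]
  set x := z.re with hx_def
  have hx : x ^ 2 - (2 + r) * x + r = 0 := by
    have := congrArg Complex.re hz
    rw [hzx] at this
    simp only [Complex.sub_re, Complex.add_re, Complex.mul_re, Complex.ofReal_re, Complex.ofReal_im,
      Complex.zero_re, pow_two, Complex.re_ofNat, mul_zero, sub_zero] at this
    nlinarith [this]
  have hR1 : 0 < R + 1 := by linarith
  rcases real_root_cases hr hrR hx with ⟨h1, h2⟩ | ⟨h1, h2⟩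
  · left
    rw [mem_closedBall, dist_eq_norm, hzx, show (x : ℂ) - 2⁻¹ = ((x - 2⁻¹ : ℝ) : ℂ) by push_cast; ring,
      Complex.norm_real, Real.norm_eq_abs, abs_le]
    have : 1 / (2 * (R + 1)) = (1 / (R + 1)) / 2 := by field_simp
    have hq : 1 / (R + 1) ≤ 1 / 2 := one_div_le_one_div_of_le (by norm_num) (by linarith)
    have hq0 : 0 < 1 / (R + 1) := by positivity
    constructor <;> nlinarith
  · right
    rw [mem_closedBall, dist_eq_norm, hzx, show (x : ℂ) - ((R + 2 : ℝ) : ℂ) = ((x - (R + 2) : ℝ) : ℂ) by push_cast; ring,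
      Complex.norm_real, Real.norm_eq_abs, abs_le]
    have hε : 0 < 1 / (2 * (R + 1)) := by positivity
    have hε' : 1 / (2 * (R + 1)) ≤ 1 := by rw [div_le_one (by positivity)]; linarith
    constructor <;> nlinarith

end Summit.ABC.IUTFork.SUnitFamily

end
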